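/-
COR-CM (cell pub-hodgecm2, stage 2 of the Hodge ladder) — count-neutral KERNEL COMBINATORICS «the sheared dihedral family», part VI: equivariance of
places, faces and gen 44ʼs functionals under the motion of `s` (seat prover-pub-hodgecm2-b23-g52-0, binder prover b23, gen 52; claim «SYLOW TRANSFER XII +
THE SHEARED DIHEDRAL FAMILY», HOME/INBOX.md l.23708).  Two bookkeeping definitions with bodies (the mask `bS` and the pattern map `pS`, shaped as gen 44ʼs
`bT`, `pT`) + theorems, on part V (`Census/ShearedDihedralModel.lean`) and gen 44ʼs `Census/QuarticInversion{Faces,Motion,Functionals,Equivariance}.lean` BY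
NAME; no `decide` beyond literals of `Fin 4`/`ZMod 2`/`Bool`, no certificate, no named fact, no geometry, no `sorry`.  `Interfaces.lean` (C1), every E term,
B01, `Transposition/*`, `PortJoin/*`, `D2Bridge/*` untouched.
HONEST FRAMING: `HC_CM` is NOT proved, here or anywhere in the tree; nothing here is a period, a count of record or a headline.
-/
import Summits.HodgeConjecture.CorCM.Census.ShearedDihedralModel
import Summits.HodgeConjecture.CorCM.Census.QuarticInversionEquivariance

/-!
# The sheared dihedral family, VI: `s` moves places by `plT`, faces to faces, and gen 44ʼs weights by the mask `{1, 3}`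

The motion `twS ((ψ₀,ψ₁),(ψ₂,ψ₃)) = ((ψ₂, ψ₃+1), (ψ₀, ψ₁+1))` of part V permutes the four coordinates by gen 44ʼs `σT = (0 2)(1 3)` — exactly as `twT` —
but conjugates the coordinates `1, 3` (mask **`bS`**) instead of `1, 2` (`bT`).  Hence, word for word as in gen 44ʼs parts IV/VIII with the mask exchanged:
* §1 `twS_conj₄`, **`twS_flipAt : twS (Θ^{(p)}) = (twS Θ)^{(plT p)}`** (places move as under `t`), **`translS_faceVec₄`** (an `s`-translate of a face is the
  face through the moved label at the moved places), `translS_mem_faceSet₄`, **`fnl_translS : fnl w (s·v) = fnl (w ∘ twS) v`**;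
* §2 **`coord_twS : coord n (twS Θ) = coord (σT n) Θ + [bS n]·𝟙`**, `half_coord_twS`, and the moved weights **`wUp_twS`**, **`wA_twS`** (pattern map `pS`),
  **`wC_twS`** — the inputs of gen 44ʼs descent/key-lemma/closing files for the X_n column (design note `HOME/pub-hodgecm2-b23/SHEARED-DIHEDRAL.md` §3b).
All [folklore].

## References
* [Pohlmann1968] H. Pohlmann, Algebraic cycles on abelian varieties of complex multiplication type, Ann. of Math. 88 (1968), Thm 1.
-/

namespace Summit.HodgeConjecture.CorCM.Census.ShearedDihedral

open Finset
open Summit.HodgeConjecture.CorCM.Census.OddSliceFacesModel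
open Summit.HodgeConjecture.CorCM.Census.DicyclicTwist (rev)
open Summit.HodgeConjecture.CorCM.Census.QuarticInversion

noncomputable section

variable (A : Type) [AddCommGroup A] [Fintype A] [DecidableEq A]

/-! ## §1 Places, faces and functionals under `s` -/

omit [Fintype A] [DecidableEq A] in
/-- Conjugation commutes with the motion of `s`. [folklore] -/
theorem twS_conj₄ (Θ : Ty₄ A) : twS A (conj₄ A Θ) = conj₄ A (twS A Θ) := by
  rw [conj₄_eq_twH₄, conj₄_eq_twH₄, twS_twH₄]

omit [AddCommGroup A] [Fintype A] in
/-- **Flips are `s`-equivariant with the place map of `t`**: `twS (Θ^{(p)}) = (twS Θ)^{(plT p)}` (`s` centralises `H₀`, so columns are kept and the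
cosets are permuted by `σT`). [folklore] -/
theorem twS_flipAt (p : Pl A) (Θ : Ty₄ A) : twS A (flipAt A p Θ) = flipAt A (plT A p) (twS A Θ) := by
  obtain ⟨k, i⟩ := p
  obtain ⟨⟨ψ₀, ψ₁⟩, ⟨ψ₂, ψ₃⟩⟩ := Θ
  fin_cases k <;> simp [flipAt, plT, σT, twS, add_right_comm _ (δ A i) (1 : Ty A)]

/-- **An `s`-translate of a face is the face through the moved label at the moved places.** [folklore] -/
theorem translS_faceVec₄ (Θ : Ty₄ A) (p q : Pl A) :
    translS A (faceVec₄ A Θ p q) = faceVec₄ A (twS A Θ) (plT A p) (plT A q) := by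
  show translSHom A (faceVec₄ A Θ p q) = _
  unfold faceVec₄
  simp only [map_add, translSHom_apply, translS_single, twS_conj₄, twS_flipAt]

/-- **`faceSet₄` is stable under the motion of `s`.** [folklore] -/
theorem translS_mem_faceSet₄ {v : Ty₄ A → ℤ} (hv : v ∈ faceSet₄ A) : translS A v ∈ faceSet₄ A := by
  obtain ⟨Θ, p, q, hpq, rfl⟩ := hv
  exact ⟨_, _, _, fun h => hpq (plT_injective A h), translS_faceVec₄ A Θ p q⟩

omit [Fintype A] [DecidableEq A] in
/-- `s` commutes with conjugation on the inverse side (`s⁻¹ = s`). [folklore] -/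
theorem twS_twS_conj₄ (Θ : Ty₄ A) : twS A (conj₄ A (twS A Θ)) = conj₄ A Θ := by
  rw [twS_conj₄, twS_twS]

/-- **`fnl w (s·v) = fnl (w ∘ s) v`.** [folklore] -/
theorem fnl_translS (w v : Ty₄ A → ℤ) : fnl A w (translS A v) = fnl A (w ∘ twS A) v := by
  rw [fnl_apply, fnl_apply]
  refine Fintype.sum_equiv (twSEquiv A).symm _ _ fun Θ => ?_
  show v (twS A Θ) * (w Θ - w (conj₄ A Θ)) = v (twS A Θ) * (w (twS A (twS A Θ)) - w (twS A (conj₄ A (twS A Θ))))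
  rw [twS_twS_conj₄, twS_twS]

/-! ## §2 Coordinates, halves and weights of `s`-moved labels -/

/-- **The mask of `s`**: the coordinates `1, 3` (those of the cosets `xH₀`, `sxH₀`, conjugated by `x s = c s x`). [folklore] -/
def bS (n : Fin 4) : Bool := decide (n = 1 ∨ n = 3)

/-- **The pattern map of `s`**: `(pS η) n = η (σT n) ⊻ bS (σT n)`. [folklore] -/
def pS (η : Fin 4 → Bool) : Fin 4 → Bool := fun n => xor (η (σT n)) (bS (σT n))

omit [AddCommGroup A] [Fintype A] [DecidableEq A] in
/-- **Coordinates of `s·Θ`**: `coord n (twS Θ) = coord (σT n) Θ + [bS n]·𝟙`. [folklore] -/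
theorem coord_twS (Θ : Ty₄ A) (n : Fin 4) : coord A n (twS A Θ) = coord A (σT n) Θ + (if bS n then 1 else 0) := by
  obtain ⟨⟨ψ₀, ψ₁⟩, ⟨ψ₂, ψ₃⟩⟩ := Θ
  fin_cases n <;> simp [coord, twS, σT, bS]

omit [AddCommGroup A] [DecidableEq A] in
/-- **Halves of `s·Θ`**: permuted by `σT`, flipped on the mask `bS`. [folklore] -/
theorem half_coord_twS (hA : Odd (Fintype.card A)) (Θ : Ty₄ A) (n : Fin 4) :
    half A (coord A n (twS A Θ)) = xor (half A (coord A (σT n) Θ)) (bS n) := by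
  rw [coord_twS, half_add_ite A hA]

omit [AddCommGroup A] [DecidableEq A] in
/-- **`wUp` after `s`**: coordinate `σT j`, same slot; conjugate on the mask `bS`. [folklore] -/
theorem wUp_twS (hA : Odd (Fintype.card A)) (j : Fin 4) (s : A) (Θ : Ty₄ A) :
    wUp A j s (twS A Θ) = if bS j then wUp A (σT j) s (conj₄ A Θ) else wUp A (σT j) s Θ := by
  have h01 : ∀ u : ZMod 2, u = 0 ∨ u = 1 := by decide
  have h11 : (1 : ZMod 2) + 1 = 0 := by decide
  cases hb : bS j
  · rw [if_neg (by decide)]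
    unfold wUp
    rw [half_coord_twS A hA, coord_twS, hb]
    simp
  · rw [if_pos rfl, wUp_conj₄ A hA]
    unfold wUp
    rw [half_coord_twS A hA, coord_twS, hb]
    simp only [if_true, Bool.xor_true, Pi.add_apply, Pi.one_apply]
    rcases h01 (coord A (σT j) Θ s) with h | h <;> cases half A (coord A (σT j) Θ) <;> simp [h, h11]

omit [AddCommGroup A] [DecidableEq A] in
/-- **The atom weight moved by `s`**: `wA j η s (s·Θ) = wA (σT j) (pS η) s Θ` off the mask `bS`, `= wA (σT j) (!pS η) s Θ̄` on it. [folklore] -/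
theorem wA_twS (hA : Odd (Fintype.card A)) (j : Fin 4) (η : Fin 4 → Bool) (s : A) (Θ : Ty₄ A) :
    wA A j η s (twS A Θ) = if bS j then wA A (σT j) (fun n => !pS η n) s (conj₄ A Θ) else wA A (σT j) (pS η) s Θ := by
  have hm := wMatch_of_perm A (σ := σT) σT_σT bS (Θ := Θ) (Θ' := twS A Θ) (fun n => half_coord_twS A hA Θ n) j η
  unfold wA
  rw [hm, wUp_twS A hA]
  cases bS j
  · rw [if_neg (by decide), if_neg (by decide)]; rfl
  · rw [if_pos rfl, if_pos rfl, wMatch_conj₄ A hA]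
    simp only [Bool.not_not]; rfl

omit [AddCommGroup A] [DecidableEq A] in
/-- **The constant weight moved by `s`.** [folklore] -/
theorem wC_twS (hA : Odd (Fintype.card A)) (η : Fin 4 → Bool) (Θ : Ty₄ A) : wC A η (twS A Θ) = wC A (pS η) Θ :=
  wC_of_perm A (σ := σT) σT_σT bS (fun n => half_coord_twS A hA Θ n) η

end

end Summit.HodgeConjecture.CorCM.Census.ShearedDihedral
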